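import Summits.RiemannHypothesis.RiemannHypothesis.Theorems.TiltedLandingLaw421R3Lens1CoverageR
import Summits.RiemannHypothesis.RiemannHypothesis.Theorems.TiltedLandingLaw421R3Lens1SignCut

/-! PROBE (not a module): landed `…R3Lens1SignCut` #1143 + `…R3Lens1CoverageR` IMPORTED; RS v1, RS2 v2, SHAPE v4 bodies inlined verbatim; the SHAPE-COVER/SELF v1 body appended. -/



/-!
# Lens-1 file RS (v9q image helper): the SUCC stub `RegHung9S` := binders of `RegRes8S` VERBATIM ∧ ¬`HungBox` ⇒ successor, and its compositions

UNCHECKED DRAFT until its two imports land (`…R3Lens1CoverageR` = `lens-1/Coverage-landable-v1R-v3.lean` 5e4f5aaf, `…R3Lens1SignCut` =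
`lens-1/SignCut-v2.lean` 0a8482f7); then `lean check` must give rc 0 · 0 sorry · STD axioms (lens-1 or the lead runs it the hour R lands, (CA484)(2)).
Declares `RegHung9S` (the v9q SUCC stub: every binder and exclusion of `RegRes8S` verbatim, plus ¬`RhW08.Lens1SignCut.HungBox f x₀ R Hs j`),
`regHung9S_of_regRes8S` (never stronger than the v8q stub), `regHung9S_of_regHungS` (implied by module S's landed-name residual),
`regRes8S_of_regHung9S` (the hung-box door `succ_of_hungBox` discharges the new binder), and
`TiltedLandingLaw421R_of_regHung9S : RegHung9S → RhW08.RateSplit.RateLawsHalfQ → crux` BY NAME.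
0 sorry.  Nothing here bears on the truth of RH; RH is not proved; ⟨33346⟩/⟨33347⟩ stay OPEN (`RegHung9S` and `RateLawsHalfQ` are hypotheses). -/

namespace RhW08.Lens1Coverage

set_option linter.dupNamespace false

open Complex Set
open scoped ComplexConjugate
open Literature.Analysis.Complex
open Summit.RiemannHypothesis.RiemannHypothesis.Theorems.Splittings.JensenWindow
open RhIdea6.G17.W07C7 RhIdea6.G17.W07C7.Rev6 RhIdea6.G18.W07C8.Law421BirthS RhIdea6.G19.W07C11.Seam
open RhIdea6.G20.W07C12.Frac RhIdea6.G20.W07C12.StColP RhW07.C12.FieldSplit RhIdea6.G21.W07C13.TentMax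
open RhW07.C14.TwoSided RhW07.C14.Classes RhW07.C14.Lineage RhW07.C14.Booking
open RhW07.C13.Heredity RhIdea6.G22.W07C15pre.Injection RhW07.E3.Cell RhW07.E3.Lit
open RhW08.Round1 RhW08.StSwap RhW08.Round2 RhW08.QuadW RhW08.SealSwapQ RhW08.SealSwap RhW08.SuccB RhW08.SuccSplit
open RhW08.SuccTheft RhW08.Column RhW08.Hurwitz RhW08.ClusterQ RhW08.ClusterQM RhW08.NewtonDoor RhW08.NewtonDoorGenusOne RhW08.PurseP
open RhW08.AntiEscapeSplit7

open RhW08.Lens1SignCut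

/-- ★ THE v9q SUCC STUB `RegHung9S` (OPEN): the binders and exclusions of `RegRes8S` verbatim, plus «`f^{(j)}` admits no hung signed box at
level `j`» (¬ `HungBox`, module S) ⇒ a level-`(j+1)` band state.  WHY IT MIGHT FAIL: the exile lens (NODE v10 §4). -/
def RegHung9S : Prop :=
  ∀ (η : ℝ) (f : ℂ → ℂ) (x₀ s hmax R Hs : ℝ) (B : ℕ), EngineHyps5 2 η f x₀ s hmax R Hs B → ∀ (j : ℕ) (v : ℂ),
    IsLowest StTrkDQ η f x₀ s hmax R Hs B j v → ¬ ReadyR2 η f x₀ s hmax R Hs B j v →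
    ¬ AllInBandInRangeWindow f x₀ R Hs j v → ¬ Dimple f j v → DiscOverlap f j v →
    iteratedDeriv (j + 1) f v ≠ 0 →
    ¬ CellF f j v → ¬ CellNb f x₀ R Hs j v → ¬ LandingDipDeep f x₀ R Hs j v → ¬ LandingDipW f x₀ R Hs j v →
    ¬ IsolatedNewtonL f x₀ R Hs j v → ¬ HungBox f x₀ R Hs j → ∃ u : ℂ, StTrkDQ η f x₀ s hmax R Hs B (j + 1) u

/-- Monotonicity: the v8q stub `RegRes8S` implies `RegHung9S` (one more hypothesis, ignored). -/
theorem regHung9S_of_regRes8S (hX : RegRes8S) : RegHung9S :=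
  fun η f x₀ s hmax R Hs B hE j v hlow hnR hwin hdim hov hz hnF hnNb hnD hnW hnI _ =>
    hX η f x₀ s hmax R Hs B hE j v hlow hnR hwin hdim hov hz hnF hnNb hnD hnW hnI

/-- Monotonicity: module S's landed-name residual `RegHungS` implies `RegHung9S` (two more hypotheses, ignored). -/
theorem regHung9S_of_regHungS (hX : RegHungS) : RegHung9S :=
  fun η f x₀ s hmax R Hs B hE j v hlow hnR hwin hdim hov hz hnF hnNb hnD _ _ hB =>
    hX η f x₀ s hmax R Hs B hE j v hlow hnR hwin hdim hov hz hnF hnNb hnD hB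

/-- ★ The hung-box door discharges the new binder: `RegHung9S ⇒ RegRes8S` (`RhW08.Lens1SignCut.succ_of_hungBox`). -/
theorem regRes8S_of_regHung9S (hX : RegHung9S) : RegRes8S := by
  intro η f x₀ s hmax R Hs B hE j v hlow hnR hwin hdim hov hz hnF hnNb hnD hnW hnI
  by_cases hB : HungBox f x₀ R Hs j
  · exact succ_of_hungBox hE hlow.1 hnR hB
  exact hX η f x₀ s hmax R Hs B hE j v hlow hnR hwin hdim hov hz hnF hnNb hnD hnW hnI hB

/-- ★★ THE CRUX BY NAME from the v9q stubs (`RegHung9S`, lens-2's `RateLawsHalfQ`), via `TiltedLandingLaw421R_of_resS`. -/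
theorem TiltedLandingLaw421R_of_regHung9S (hX : RegHung9S) (hR : RhW08.RateSplit.RateLawsHalfQ) :
    Summit.RiemannHypothesis.RiemannHypothesis.Theses.EarlyAppointments.TiltedLandingLaw421R :=
  TiltedLandingLaw421R_of_resS (regRes8S_of_regHung9S hX) hR

end RhW08.Lens1Coverage

-- ===== RS2 body (CoverageRS2-v2.lean, from `namespace` on, verbatim) =====
namespace RhW08.Lens1Coverage

set_option linter.dupNamespace false

open Complex Set
open scoped ComplexConjugate
open Literature.Analysis.Complex
open Summit.RiemannHypothesis.RiemannHypothesis.Theorems.Splittings.JensenWindow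
open RhIdea6.G17.W07C7 RhIdea6.G17.W07C7.Rev6 RhIdea6.G18.W07C8.Law421BirthS RhIdea6.G19.W07C11.Seam
open RhIdea6.G20.W07C12.Frac RhIdea6.G20.W07C12.StColP RhW07.C12.FieldSplit RhIdea6.G21.W07C13.TentMax
open RhW07.C14.TwoSided RhW07.C14.Classes RhW07.C14.Lineage RhW07.C14.Booking
open RhW07.C13.Heredity RhIdea6.G22.W07C15pre.Injection RhW07.E3.Cell RhW07.E3.Lit
open RhW08.Round1 RhW08.StSwap RhW08.Round2 RhW08.QuadW RhW08.SealSwapQ RhW08.SealSwap RhW08.SuccB RhW08.SuccSplit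
open RhW08.SuccTheft RhW08.Column RhW08.Hurwitz RhW08.ClusterQ RhW08.ClusterQM RhW08.NewtonDoor RhW08.NewtonDoorGenusOne RhW08.PurseP
open RhW08.AntiEscapeSplit7

open RhW08.Lens1SignCut

/-- ★ THE SUCC RESIDUAL IN LINEAGE CURRENCY `RegHungCut10S` (OPEN): binders/exclusions of `RegHung9S` verbatim, plus «some level `i ≤ j` is NOT
column-cuttable» ⇒ a level-`(j+1)` band state.  WHY IT MIGHT FAIL: A3′ (column-lineage surfing + terminal steal, crit-1 HANDS-30) — an in-class frame whose
central lineage escapes laterally through an uncuttable cluster and whose last child is stolen out of the level-(j+1) window. -/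
def RegHungCut10S : Prop :=
  ∀ (η : ℝ) (f : ℂ → ℂ) (x₀ s hmax R Hs : ℝ) (B : ℕ), EngineHyps5 2 η f x₀ s hmax R Hs B → ∀ (j : ℕ) (v : ℂ),
    IsLowest StTrkDQ η f x₀ s hmax R Hs B j v → ¬ ReadyR2 η f x₀ s hmax R Hs B j v →
    ¬ AllInBandInRangeWindow f x₀ R Hs j v → ¬ Dimple f j v → DiscOverlap f j v →
    iteratedDeriv (j + 1) f v ≠ 0 →
    ¬ CellF f j v → ¬ CellNb f x₀ R Hs j v → ¬ LandingDipDeep f x₀ R Hs j v → ¬ LandingDipW f x₀ R Hs j v →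
    ¬ IsolatedNewtonL f x₀ R Hs j v → ¬ HungBox f x₀ R Hs j → (∃ i : ℕ, i ≤ j ∧ ¬ ColumnCuttable f x₀ R Hs i) →
    ∃ u : ℂ, StTrkDQ η f x₀ s hmax R Hs B (j + 1) u

/-- Monotonicity: `RegHung9S ⇒ RegHungCut10S` (one more hypothesis, ignored). -/
theorem regHungCut10S_of_regHung9S (hX : RegHung9S) : RegHungCut10S :=
  fun η f x₀ s hmax R Hs B hE j v hlow hnR hwin hdim hov hz hnF hnNb hnD hnW hnI hB _ =>
    hX η f x₀ s hmax R Hs B hE j v hlow hnR hwin hdim hov hz hnF hnNb hnD hnW hnI hB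

/-- ★ The lineage door discharges the new binder: `RegHungCut10S ⇒ RegHung9S` (`RhW08.Lens1SignCut.succ_of_columnCuttable_upTo`). -/
theorem regHung9S_of_regHungCut10S (hX : RegHungCut10S) : RegHung9S := by
  intro η f x₀ s hmax R Hs B hE j v hlow hnR hwin hdim hov hz hnF hnNb hnD hnW hnI hB
  by_cases hcut : ∀ i : ℕ, i ≤ j → ColumnCuttable f x₀ R Hs i
  · exact succ_of_columnCuttable_upTo v hE hnR hcut
  obtain ⟨i, hi⟩ := not_forall.mp hcut
  exact hX η f x₀ s hmax R Hs B hE j v hlow hnR hwin hdim hov hz hnF hnNb hnD hnW hnI hB ⟨i, Classical.not_imp.mp hi⟩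

/-- Hence also `RegHungCut10S ⇒ RegRes8S` (v8q currency). -/
theorem regRes8S_of_regHungCut10S (hX : RegHungCut10S) : RegRes8S :=
  regRes8S_of_regHung9S (regHung9S_of_regHungCut10S hX)

/-- ★★ THE CRUX BY NAME from the lineage-currency stub and lens-2's `RateLawsHalfQ`. -/
theorem TiltedLandingLaw421R_of_regHungCut10S (hX : RegHungCut10S) (hR : RhW08.RateSplit.RateLawsHalfQ) :
    Summit.RiemannHypothesis.RiemannHypothesis.Theses.EarlyAppointments.TiltedLandingLaw421R :=
  TiltedLandingLaw421R_of_regHung9S (regHung9S_of_regHungCut10S hX) hR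

/-- ★ INHABITANT SHAPE in lineage currency ((CA494) O2, proved): if some level `≤ j` is not column-cuttable (the extra binder of `RegHungCut10S`)
at a non-`ReadyR2` level `j`, then at the FIRST such level `i₀` every lower level is cuttable, the central lineage has delivered a column couple at
EVERY level `≤ i₀` (`colCouple_succ_of_cuttable` from the booked pair `w₀`), and that level-`i₀` column couple admits no signed bracket inside the
closed column — i.e. the configuration a prover/adversary must handle is «a column couple of `f^{(i₀)}` edge-connected (through the set where the
boundary sign fails at some height `≤ Hs`) to a column wall», nothing else (crit-1 A3′). -/
theorem inhabitant_shape {η : ℝ} {f : ℂ → ℂ} {x₀ s hmax R Hs : ℝ} {B j : ℕ} (v : ℂ)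
    (hE : EngineHyps5 2 η f x₀ s hmax R Hs B) (hnR : ¬ ReadyR2 η f x₀ s hmax R Hs B j v)
    (h : ∃ i : ℕ, i ≤ j ∧ ¬ ColumnCuttable f x₀ R Hs i) :
    ∃ i₀ : ℕ, i₀ ≤ j ∧ ¬ ColumnCuttable f x₀ R Hs i₀ ∧ (∀ i : ℕ, i < i₀ → ColumnCuttable f x₀ R Hs i) ∧
      (∀ k : ℕ, k ≤ i₀ → ColCouple f x₀ R k) := by
  classical
  have hspec := Nat.find_spec h
  have hmin : ∀ i : ℕ, i < Nat.find h → ColumnCuttable f x₀ R Hs i := by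
    intro i hi
    by_contra hc
    exact Nat.find_min h hi ⟨by have := hspec.1; omega, hc⟩
  refine ⟨Nat.find h, hspec.1, hspec.2, hmin, ?_⟩
  have hRpos : 0 < R := R_pos_of_engine hE
  intro k
  induction k with
  | zero =>
    intro _
    obtain ⟨w₀, hw₀, hw₀im, hw₀re, -⟩ := hE.2.2.2.2.2.2.2.2.2.2.1
    exact ⟨w₀, by rw [iteratedDeriv_zero]; exact hw₀, hw₀im, by rw [hw₀re, sub_self, abs_zero]; linarith⟩
  | succ k ih =>
    intro hk
    have hkj : k ≤ j := by have := hspec.1; omega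
    have hnRk : ¬ ReadyR2 η f x₀ s hmax R Hs B k v := fun h' => hnR (readyR2_mono h' hkj)
    have hnW : ¬ WindowReady η f x₀ s hmax R Hs B k v := fun hW => hnRk (cumReady_of_ready (Ready := WinOrTilt) (Or.inl hW))
    exact colCouple_succ_of_cuttable v hE (RhW08.LineageQ.iteratedDeriv_ne_zero_of_not_readyR2 hE k v hnRk).1 (ih (by omega)) (hmin k (by omega)) hnW

end RhW08.Lens1Coverage


-- ===== SHAPE body (Shape-v4.lean, from `namespace` on, verbatim) =====
namespace RhW08.Lens1Shape

set_option linter.dupNamespace false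

open Complex Set
open scoped ComplexConjugate
open Literature.Analysis.Complex
open Summit.RiemannHypothesis.RiemannHypothesis.Theorems.Splittings.JensenWindow
open RhIdea6.G17.W07C7 RhIdea6.G17.W07C7.Rev6 RhIdea6.G18.W07C8.Law421BirthS RhIdea6.G19.W07C11.Seam
open RhIdea6.G20.W07C12.Frac RhIdea6.G20.W07C12.StColP RhW07.C12.FieldSplit RhIdea6.G21.W07C13.TentMax
open RhW07.C14.TwoSided RhW07.C14.Classes RhW07.C14.Lineage RhW07.C14.Booking
open RhW07.C13.Heredity RhIdea6.G22.W07C15pre.Injection RhW07.E3.Cell RhW07.E3.Lit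
open RhW08.Round1 RhW08.StSwap RhW08.Round2 RhW08.QuadW RhW08.SealSwapQ RhW08.SealSwap RhW08.SuccB RhW08.SuccSplit
open RhW08.SuccTheft RhW08.Column RhW08.Hurwitz RhW08.ClusterQ RhW08.ClusterQM RhW08.NewtonDoor RhW08.NewtonDoorGenusOne RhW08.PurseP
open RhW08.AntiEscapeSplit7

open RhW08.Lens1SignCut
open RhW08.Lens1Coverage

/-- `x` is SHADOWED at level `i` (below height `Hs`): some point of the vertical through `x` at a height `y ∈ (0, Hs]` lies in the CLOSED Jensen
disc of a non-real zero `a` of `f^{(i)}` (`(x − Re a)² + y² ≤ Im a²`, so `|x − Re a| < |Im a|`). -/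
def Shadowed (f : ℂ → ℂ) (Hs : ℝ) (i : ℕ) (x : ℝ) : Prop :=
  ∃ y ∈ Ioc (0 : ℝ) Hs, ¬ JensenClear (iteratedDeriv i f) ((x : ℂ) + (y : ℂ) * I)

/-- `x` is a BAD FOOT at level `i`: `f^{(i)}(x) = 0` or `f^{(i+1)}(x) = 0` (a discrete set of exceptions). -/
def BadFoot (f : ℂ → ℂ) (i : ℕ) (x : ℝ) : Prop :=
  iteratedDeriv i f x = 0 ∨ deriv (iteratedDeriv i f) x = 0

/-- ★ SHADOW COVER (the kernel meaning of «edge-connected», proved): on a legal frame, if level `i` is NOT column-cuttable then some column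
couple `c` of `f^{(i)}` has ONE WHOLE SIDE of the closed column — every `α ∈ [x₀ − R/2, Re c)` or every `β ∈ (Re c, x₀ + R/2]` — consisting of
bad feet and SHADOWED abscissae only: every vertical there meets, at some height `≤ Hs`, the closed Jensen disc of a non-real zero of `f^{(i)}`
(contrapositive of `sgn_of_jensenClear`, Kim 1996 (2.3): a Jensen-clear vertical with good feet is a signed transversal).  So the A3′ object is a
chain of Jensen discs of zeros of `f^{(i₀)}` at heights `≤ Hs` joining the column couple to a column wall. -/
theorem shadowCover_of_not_cuttable {η : ℝ} {f : ℂ → ℂ} {x₀ s hmax R Hs : ℝ} {B : ℕ}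
    (hE : EngineHyps5 2 η f x₀ s hmax R Hs B) (i : ℕ) (hnc : ¬ ColumnCuttable f x₀ R Hs i) :
    ∃ c : ℂ, iteratedDeriv i f c = 0 ∧ c.im ≠ 0 ∧ |c.re - x₀| < R / 2 ∧
      ((∀ α : ℝ, x₀ - R / 2 ≤ α → α < c.re → BadFoot f i α ∨ Shadowed f Hs i α) ∨
       (∀ β : ℝ, c.re < β → β ≤ x₀ + R / 2 → BadFoot f i β ∨ Shadowed f Hs i β)) := by
  by_contra H
  apply hnc
  intro c hc hcim hcre
  have H' : ¬ ((∀ α : ℝ, x₀ - R / 2 ≤ α → α < c.re → BadFoot f i α ∨ Shadowed f Hs i α) ∨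
      (∀ β : ℝ, c.re < β → β ≤ x₀ + R / 2 → BadFoot f i β ∨ Shadowed f Hs i β)) := fun h => H ⟨c, hc, hcim, hcre, h⟩
  push Not at H'
  obtain ⟨⟨α, hα1, hα2, hαF, hαS⟩, ⟨β, hβ1, hβ2, hβF, hβS⟩⟩ := H'
  have imS : ∀ a y : ℝ, ((a : ℂ) + (y : ℂ) * I).im = y := by intro a y; simp
  have sgn : ∀ a y : ℝ, 0 < y → JensenClear (iteratedDeriv i f) ((a : ℂ) + (y : ℂ) * I) →
      (deriv (iteratedDeriv i f) ((a : ℂ) + (y : ℂ) * I) / iteratedDeriv i f ((a : ℂ) + (y : ℂ) * I)).im < 0 := by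
    intro a y hy hcl
    have h1 := sgn_of_jensenClear (realEntireLt2_of_hyps hE) i ⟨c, hc⟩ (w := (a : ℂ) + (y : ℂ) * I) (by rw [imS]; exact hy.ne') hcl
    rw [imS] at h1
    exact neg_of_mul_neg_right h1 hy.le
  have clα : ∀ y ∈ Ioc (0 : ℝ) Hs, JensenClear (iteratedDeriv i f) ((α : ℂ) + (y : ℂ) * I) := fun y hy => by
    by_contra h; exact hαS ⟨y, hy, h⟩
  have clβ : ∀ y ∈ Ioc (0 : ℝ) Hs, JensenClear (iteratedDeriv i f) ((β : ℂ) + (y : ℂ) * I) := fun y hy => by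
    by_contra h; exact hβS ⟨y, hy, h⟩
  unfold BadFoot at hαF hβF
  exact ⟨α, β, hα1, hβ2, hα2, hβ1, (not_or.mp hαF).1, (not_or.mp hβF).1, (not_or.mp hαF).2, (not_or.mp hβF).2,
    fun y hy => sgn α y hy.1 (clα y hy), fun y hy => sgn β y hy.1 (clβ y hy)⟩

/-- ★ THE A3′ OBJECT, assembled (proved): a hyps-inhabitant of the lineage binder at a non-`ReadyR2` level `j` yields a first uncuttable level
`i₀ ≤ j` (lower levels cuttable, a column couple at every level `≤ i₀`) together with a level-`i₀` column couple one of whose column sides is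
shadow-covered (bad feet ∪ Jensen shadows at heights `≤ Hs`). -/
theorem a3_object {η : ℝ} {f : ℂ → ℂ} {x₀ s hmax R Hs : ℝ} {B j : ℕ} (v : ℂ)
    (hE : EngineHyps5 2 η f x₀ s hmax R Hs B) (hnR : ¬ ReadyR2 η f x₀ s hmax R Hs B j v)
    (h : ∃ i : ℕ, i ≤ j ∧ ¬ ColumnCuttable f x₀ R Hs i) :
    ∃ i₀ : ℕ, i₀ ≤ j ∧ (∀ i : ℕ, i < i₀ → ColumnCuttable f x₀ R Hs i) ∧ (∀ k : ℕ, k ≤ i₀ → ColCouple f x₀ R k) ∧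
      ∃ c : ℂ, iteratedDeriv i₀ f c = 0 ∧ c.im ≠ 0 ∧ |c.re - x₀| < R / 2 ∧
        ((∀ α : ℝ, x₀ - R / 2 ≤ α → α < c.re → BadFoot f i₀ α ∨ Shadowed f Hs i₀ α) ∨
         (∀ β : ℝ, c.re < β → β ≤ x₀ + R / 2 → BadFoot f i₀ β ∨ Shadowed f Hs i₀ β)) := by
  obtain ⟨i₀, hi₀, hnc, hmin, hcc⟩ := RhW08.Lens1Coverage.inhabitant_shape v hE hnR h
  exact ⟨i₀, hi₀, hmin, hcc, shadowCover_of_not_cuttable hE i₀ hnc⟩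

end RhW08.Lens1Shape

-- ===== SHAPE-COVER/SELF body (ShapeCoverSelf-v1.lean, from `namespace` on, verbatim) =====
namespace RhW08.Lens1Shape

set_option linter.dupNamespace false

open Complex Set
open scoped ComplexConjugate
open Literature.Analysis.Complex
open Summit.RiemannHypothesis.RiemannHypothesis.Theorems.Splittings.JensenWindow
open RhIdea6.G17.W07C7 RhIdea6.G17.W07C7.Rev6 RhIdea6.G18.W07C8.Law421BirthS RhIdea6.G19.W07C11.Seam
open RhIdea6.G20.W07C12.Frac RhIdea6.G20.W07C12.StColP RhW07.C12.FieldSplit RhIdea6.G21.W07C13.TentMax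
open RhW07.C14.TwoSided RhW07.C14.Classes RhW07.C14.Lineage RhW07.C14.Booking
open RhW07.C13.Heredity RhIdea6.G22.W07C15pre.Injection RhW07.E3.Cell RhW07.E3.Lit
open RhW08.Round1 RhW08.StSwap RhW08.Round2 RhW08.QuadW RhW08.SealSwapQ RhW08.SealSwap RhW08.SuccB RhW08.SuccSplit
open RhW08.SuccTheft RhW08.Column RhW08.Hurwitz RhW08.ClusterQ RhW08.ClusterQM RhW08.NewtonDoor RhW08.NewtonDoorGenusOne RhW08.PurseP
open RhW08.AntiEscapeSplit7
open RhW08.Lens1SignCut RhW08.Lens1Coverage RhW08.LineageQ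

/-! ## §1 Gap cuts: an unshadowed abscissa with good feet is a signed vertical transversal -/

/-- ★ DISC CRITERION: if no non-real zero `a` of `f^{(i)}` has `|x − Re a| < |Im a|` (the open real shadow of every Jensen disc misses `x`),
then `x` is NOT shadowed (at any height).  The tangent abscissa `Re c + Im c` of a disc is never shadowed by that disc. -/
theorem not_shadowed_of_discs {f : ℂ → ℂ} {Hs : ℝ} (i : ℕ) {x : ℝ}
    (h : ∀ a : ℂ, iteratedDeriv i f a = 0 → a.im ≠ 0 → |a.im| ≤ |x - a.re|) : ¬ Shadowed f Hs i x := by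
  rintro ⟨y, hy, hns⟩
  apply hns
  intro a ha haim
  have hre : (((x : ℂ) + (y : ℂ) * I) - (a.re : ℂ)).re = x - a.re := by simp
  have him : (((x : ℂ) + (y : ℂ) * I) - (a.re : ℂ)).im = y := by simp
  have hsq : (x - a.re) ^ 2 < ‖((x : ℂ) + (y : ℂ) * I) - (a.re : ℂ)‖ ^ 2 := by
    rw [Complex.sq_norm, Complex.normSq_apply, hre, him]
    nlinarith [hy.1]
  have hlt : |x - a.re| < ‖((x : ℂ) + (y : ℂ) * I) - (a.re : ℂ)‖ := abs_lt_of_sq_lt_sq hsq (norm_nonneg _)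
  exact lt_of_le_of_lt (h a ha haim) hlt

/-- ★ GAP CUT: on a legal frame (`f^{(i)}` with a zero), an unshadowed abscissa carries the boundary sign `Im (F′/F) < 0` at every height
`y ∈ (0, Hs]` (`sgn_of_jensenClear`, Kim 1996 (2.3)). -/
theorem signedCut_of_not_shadowed {η : ℝ} {f : ℂ → ℂ} {x₀ s hmax R Hs : ℝ} {B : ℕ} (hE : EngineHyps5 2 η f x₀ s hmax R Hs B) (i : ℕ)
    (hex : ∃ a, iteratedDeriv i f a = 0) {x : ℝ} (hS : ¬ Shadowed f Hs i x) :
    ∀ y ∈ Ioc (0 : ℝ) Hs,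
      (deriv (iteratedDeriv i f) ((x : ℂ) + (y : ℂ) * I) / iteratedDeriv i f ((x : ℂ) + (y : ℂ) * I)).im < 0 := by
  intro y hy
  have imS : ((x : ℂ) + (y : ℂ) * I).im = y := by simp
  have hcl : JensenClear (iteratedDeriv i f) ((x : ℂ) + (y : ℂ) * I) := by
    by_contra hc
    exact hS ⟨y, hy, hc⟩
  have h1 := sgn_of_jensenClear (realEntireLt2_of_hyps hE) i hex (w := (x : ℂ) + (y : ℂ) * I) (by rw [imS]; exact hy.1.ne') hcl
  rw [imS] at h1
  exact neg_of_mul_neg_right h1 hy.1.le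

/-! ## §2 The off-column hang clause (join of `hangClause_of_inBand` and `hangClause_of_corner`) and the in-band box door -/

/-- ★★ OFF-COLUMN HANG CLAUSE.  For the full-height box `[α, β] × (0, Hs+1)` at level `i`: a point under a host's closed disc that lies in
the closed column satisfies the level-`(i+1)` band inequality outright; a point beyond a wall lies strictly inside the host's open shadow, so the
host's disc pokes out of the column (`R/2 < |Re a − x₀| + Im a`) and its shadow meets `(α, β)` — and only such hosts are asked to be level-`i`
band points (then Jensen nesting `band_step'`). -/
theorem hangClause_of_offColumn {η : ℝ} {f : ℂ → ℂ} {x₀ s hmax R Hs : ℝ} {B i : ℕ} (hE : EngineHyps5 2 η f x₀ s hmax R Hs B)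
    (hnz : iteratedDeriv i f ≠ 0) {α β : ℝ}
    (hout : ∀ a : ℂ, iteratedDeriv i f a = 0 → 0 < a.im → α < a.re + a.im → a.re - a.im < β → R / 2 < |a.re - x₀| + a.im →
      (max (|a.re - x₀| - R / 2) 0) ^ 2 + (i : ℝ) * a.im ^ 2 ≤ (i : ℝ) * Hs ^ 2) :
    HangClause (iteratedDeriv i f) x₀ R Hs i α β (Hs + 1) := by
  intro a z ha hapos hz hdisc
  rw [mem_reProdIm] at hz
  obtain ⟨⟨hzα, hzβ⟩, hz0, -⟩ := hz
  have haHs : a.im ≤ Hs := by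
    have h1 := abs_im_le_of_level hE hnz ha
    rwa [abs_of_pos hapos] at h1
  have haHs2 : a.im ^ 2 ≤ Hs ^ 2 := by nlinarith
  have hzim2 : z.im ^ 2 ≤ Hs ^ 2 := by nlinarith [sq_nonneg (z.re - a.re)]
  have hj : (0 : ℝ) ≤ (i : ℝ) + 1 := by positivity
  by_cases hcol : |z.re - x₀| ≤ R / 2
  · -- a point of the closed column: the level-(i+1) band inequality outright
    have hmax : max (|z.re - x₀| - R / 2) 0 = 0 := max_eq_right (by linarith)
    rw [hmax]
    nlinarith [mul_le_mul_of_nonneg_left hzim2 hj]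
  · -- a point beyond a wall: strictly inside the host's open shadow, so the host pokes out of the column
    push Not at hcol
    have hz2 : 0 < z.im ^ 2 := by positivity
    have hsh : (z.re - a.re) ^ 2 < a.im ^ 2 := by linarith
    have hsh' : |z.re - a.re| < a.im := abs_lt_of_sq_lt_sq hsh hapos.le
    obtain ⟨hl, hr⟩ := abs_lt.1 hsh'
    have h1 : α < a.re + a.im := by linarith
    have h2 : a.re - a.im < β := by linarith
    have h3 : R / 2 < |a.re - x₀| + a.im := by
      have htri : |z.re - x₀| ≤ |z.re - a.re| + |a.re - x₀| := by
        have := abs_add_le (z.re - a.re) (a.re - x₀)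
        rwa [show z.re - a.re + (a.re - x₀) = z.re - x₀ by ring] at this
      linarith
    exact band_step' (hout a ha hapos h1 h2 h3) haHs2 (by unfold NestedStep; linarith)

/-- ★★ THE IN-BAND BOX DOOR («K-GAP», instrumentable on zero positions + two sign checks).  Legal frame, `f^{(i)} ≢ 0`, two vertical
transversals `α < β` in the LAW's range signed on heights `(0, Hs]` with `F·F′ ≠ 0` at their feet (e.g. gap cuts, §1), a couple of `f^{(i)}`
with real part in `(α, β)`, and every upper zero whose disc pokes out of the closed column and whose shadow meets `(α, β)` a level-`i` band point
⇒ `HungBox f x₀ R Hs i` (free top `signedRect_of_cuts`, `hangClause_of_offColumn`).  Contains the column-cut box (there `hout` is idle). -/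
theorem hungBox_of_cuts_inBand {η : ℝ} {f : ℂ → ℂ} {x₀ s hmax R Hs : ℝ} {B i : ℕ} (hE : EngineHyps5 2 η f x₀ s hmax R Hs B)
    (hnz : iteratedDeriv i f ≠ 0) {α β : ℝ}
    (hαr : x₀ - ((i : ℝ) + 3) * R / 2 ≤ α) (hβr : β ≤ x₀ + ((i : ℝ) + 3) * R / 2) (hlt : α < β)
    (hFα : iteratedDeriv i f α ≠ 0) (hFβ : iteratedDeriv i f β ≠ 0)
    (hdα : deriv (iteratedDeriv i f) α ≠ 0) (hdβ : deriv (iteratedDeriv i f) β ≠ 0)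
    (hsα : ∀ y ∈ Ioc (0 : ℝ) Hs,
      (deriv (iteratedDeriv i f) ((α : ℂ) + (y : ℂ) * I) / iteratedDeriv i f ((α : ℂ) + (y : ℂ) * I)).im < 0)
    (hsβ : ∀ y ∈ Ioc (0 : ℝ) Hs,
      (deriv (iteratedDeriv i f) ((β : ℂ) + (y : ℂ) * I) / iteratedDeriv i f ((β : ℂ) + (y : ℂ) * I)).im < 0)
    (hJ : ∃ u : ℂ, iteratedDeriv i f u = 0 ∧ u.im ≠ 0 ∧ α < u.re ∧ u.re < β)
    (hout : ∀ a : ℂ, iteratedDeriv i f a = 0 → 0 < a.im → α < a.re + a.im → a.re - a.im < β → R / 2 < |a.re - x₀| + a.im →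
      (max (|a.re - x₀| - R / 2) 0) ^ 2 + (i : ℝ) * a.im ^ 2 ≤ (i : ℝ) * Hs ^ 2) :
    HungBox f x₀ R Hs i := by
  obtain ⟨u, hu, huim, huα, huβ⟩ := hJ
  have hR := signedRect_of_cuts hE hnz ⟨u, hu⟩ hlt hFα hFβ hdα hdβ hsα hsβ
  exact ⟨α, β, Hs + 1, hαr, hβr, hR, ⟨u, mem_box_of_zero hE hnz hu huα huβ, hu, huim⟩, hangClause_of_offColumn hE hnz hout⟩

/-! ## §3 The SELF-shadow door (right-hand version with its corollaries; the left-hand mirror `hungBox_of_selfShadowL`) -/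

/-- ★★ SELF-SHADOW DOOR (right).  Legal frame, `f^{(i)} ≢ 0`, an upper column couple `c` (typically with `x₀ + R/2 < Re c + Im c`: its own
disc covers the right column side — the hypothesis is not needed for the conclusion), a left cut `α ∈ [x₀ − R/2, Re c)` signed on `(0, Hs]` with
good feet, good feet at the TANGENT ABSCISSA `β := Re c + Im c`, no zero's open shadow containing `β` (for `c` itself this is equality), and every
upper zero whose disc pokes out of the column with shadow meeting `(α, β)` a level-`i` band point ⇒ `HungBox f x₀ R Hs i`.
Range: `β ≤ x₀ + R/2 + Hs ≤ x₀ + R ≤ x₀ + (i+3)R/2`. -/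
theorem hungBox_of_selfShadowR {η : ℝ} {f : ℂ → ℂ} {x₀ s hmax R Hs : ℝ} {B i : ℕ} (hE : EngineHyps5 2 η f x₀ s hmax R Hs B)
    (hnz : iteratedDeriv i f ≠ 0) {c : ℂ} (hc : iteratedDeriv i f c = 0) (hcpos : 0 < c.im) (hccol : |c.re - x₀| < R / 2)
    {α : ℝ} (hα : x₀ - R / 2 ≤ α) (hαc : α < c.re)
    (hFα : iteratedDeriv i f α ≠ 0) (hdα : deriv (iteratedDeriv i f) α ≠ 0)
    (hsα : ∀ y ∈ Ioc (0 : ℝ) Hs,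
      (deriv (iteratedDeriv i f) ((α : ℂ) + (y : ℂ) * I) / iteratedDeriv i f ((α : ℂ) + (y : ℂ) * I)).im < 0)
    (hFβ : iteratedDeriv i f ((c.re + c.im : ℝ) : ℂ) ≠ 0) (hdβ : deriv (iteratedDeriv i f) ((c.re + c.im : ℝ) : ℂ) ≠ 0)
    (hT : ∀ a : ℂ, iteratedDeriv i f a = 0 → a.im ≠ 0 → |a.im| ≤ |c.re + c.im - a.re|)
    (hout : ∀ a : ℂ, iteratedDeriv i f a = 0 → 0 < a.im → α < a.re + a.im → a.re - a.im < c.re + c.im → R / 2 < |a.re - x₀| + a.im →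
      (max (|a.re - x₀| - R / 2) 0) ^ 2 + (i : ℝ) * a.im ^ 2 ≤ (i : ℝ) * Hs ^ 2) :
    HungBox f x₀ R Hs i := by
  have hRpos : 0 < R := R_pos_of_engine hE
  have hHsR : 2 * Hs ≤ R := hE.2.2.2.2.2.2.2.2.2.1
  have hi0 : (0 : ℝ) ≤ (i : ℝ) := by positivity
  have hcHs : c.im ≤ Hs := by
    have h1 := abs_im_le_of_level hE hnz hc
    rwa [abs_of_pos hcpos] at h1
  have hcre : c.re < x₀ + R / 2 := by linarith [(abs_lt.1 hccol).2]
  have hiR : R ≤ ((i : ℝ) + 3) * R / 2 := by nlinarith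
  have hβr : c.re + c.im ≤ x₀ + ((i : ℝ) + 3) * R / 2 := by linarith
  have hαr : x₀ - ((i : ℝ) + 3) * R / 2 ≤ α := by linarith
  have hlt : α < c.re + c.im := by linarith
  have hS : ¬ Shadowed f Hs i (c.re + c.im) := not_shadowed_of_discs i hT
  have hsβ := signedCut_of_not_shadowed hE i ⟨c, hc⟩ hS
  exact hungBox_of_cuts_inBand hE hnz hαr hβr hlt hFα hFβ hdα hdβ hsα hsβ ⟨c, hc, hcpos.ne', hαc, by linarith⟩ hout

/-- ★ SELF-SHADOW DOOR (left; mirror of `hungBox_of_selfShadowR`): upper column couple `c`, a right cut `β ∈ (Re c, x₀ + R/2]`, good feet and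
no open shadow at the left tangent abscissa `α := Re c − Im c`, out-of-column intruders in band ⇒ `HungBox f x₀ R Hs i`. -/
theorem hungBox_of_selfShadowL {η : ℝ} {f : ℂ → ℂ} {x₀ s hmax R Hs : ℝ} {B i : ℕ} (hE : EngineHyps5 2 η f x₀ s hmax R Hs B)
    (hnz : iteratedDeriv i f ≠ 0) {c : ℂ} (hc : iteratedDeriv i f c = 0) (hcpos : 0 < c.im) (hccol : |c.re - x₀| < R / 2)
    {β : ℝ} (hβ : β ≤ x₀ + R / 2) (hcβ : c.re < β)
    (hFβ : iteratedDeriv i f β ≠ 0) (hdβ : deriv (iteratedDeriv i f) β ≠ 0)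
    (hsβ : ∀ y ∈ Ioc (0 : ℝ) Hs,
      (deriv (iteratedDeriv i f) ((β : ℂ) + (y : ℂ) * I) / iteratedDeriv i f ((β : ℂ) + (y : ℂ) * I)).im < 0)
    (hFα : iteratedDeriv i f ((c.re - c.im : ℝ) : ℂ) ≠ 0) (hdα : deriv (iteratedDeriv i f) ((c.re - c.im : ℝ) : ℂ) ≠ 0)
    (hT : ∀ a : ℂ, iteratedDeriv i f a = 0 → a.im ≠ 0 → |a.im| ≤ |c.re - c.im - a.re|)
    (hout : ∀ a : ℂ, iteratedDeriv i f a = 0 → 0 < a.im → c.re - c.im < a.re + a.im → a.re - a.im < β → R / 2 < |a.re - x₀| + a.im →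
      (max (|a.re - x₀| - R / 2) 0) ^ 2 + (i : ℝ) * a.im ^ 2 ≤ (i : ℝ) * Hs ^ 2) :
    HungBox f x₀ R Hs i := by
  have hRpos : 0 < R := R_pos_of_engine hE
  have hHsR : 2 * Hs ≤ R := hE.2.2.2.2.2.2.2.2.2.1
  have hi0 : (0 : ℝ) ≤ (i : ℝ) := by positivity
  have hcHs : c.im ≤ Hs := by
    have h1 := abs_im_le_of_level hE hnz hc
    rwa [abs_of_pos hcpos] at h1
  have hcre : x₀ - R / 2 < c.re := by linarith [(abs_lt.1 hccol).1]
  have hiR : R ≤ ((i : ℝ) + 3) * R / 2 := by nlinarith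
  have hαr : x₀ - ((i : ℝ) + 3) * R / 2 ≤ c.re - c.im := by linarith
  have hβr : β ≤ x₀ + ((i : ℝ) + 3) * R / 2 := by linarith
  have hlt : c.re - c.im < β := by linarith
  have hS : ¬ Shadowed f Hs i (c.re - c.im) := not_shadowed_of_discs i hT
  have hsα := signedCut_of_not_shadowed hE i ⟨c, hc⟩ hS
  exact hungBox_of_cuts_inBand hE hnz hαr hβr hlt hFα hFβ hdα hdβ hsα hsβ ⟨c, hc, hcpos.ne', by linarith, hcβ⟩ hout

/-- ★ SELF ⇒ successor-or-`ReadyR2` AT LEVEL `i` (`c` itself is the band state the hung-box door wants: column immunity `stTrkDQ_of_column`;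
`ReadyR2` is state-free, so it is reported at any `v`). -/
theorem succ_or_readyR2_of_selfShadowR {η : ℝ} {f : ℂ → ℂ} {x₀ s hmax R Hs : ℝ} {B i : ℕ} (v : ℂ)
    (hE : EngineHyps5 2 η f x₀ s hmax R Hs B)
    (hnz : iteratedDeriv i f ≠ 0) {c : ℂ} (hc : iteratedDeriv i f c = 0) (hcpos : 0 < c.im) (hccol : |c.re - x₀| < R / 2)
    {α : ℝ} (hα : x₀ - R / 2 ≤ α) (hαc : α < c.re)
    (hFα : iteratedDeriv i f α ≠ 0) (hdα : deriv (iteratedDeriv i f) α ≠ 0)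
    (hsα : ∀ y ∈ Ioc (0 : ℝ) Hs,
      (deriv (iteratedDeriv i f) ((α : ℂ) + (y : ℂ) * I) / iteratedDeriv i f ((α : ℂ) + (y : ℂ) * I)).im < 0)
    (hFβ : iteratedDeriv i f ((c.re + c.im : ℝ) : ℂ) ≠ 0) (hdβ : deriv (iteratedDeriv i f) ((c.re + c.im : ℝ) : ℂ) ≠ 0)
    (hT : ∀ a : ℂ, iteratedDeriv i f a = 0 → a.im ≠ 0 → |a.im| ≤ |c.re + c.im - a.re|)
    (hout : ∀ a : ℂ, iteratedDeriv i f a = 0 → 0 < a.im → α < a.re + a.im → a.re - a.im < c.re + c.im → R / 2 < |a.re - x₀| + a.im →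
      (max (|a.re - x₀| - R / 2) 0) ^ 2 + (i : ℝ) * a.im ^ 2 ≤ (i : ℝ) * Hs ^ 2) :
    (∃ u : ℂ, StTrkDQ η f x₀ s hmax R Hs B (i + 1) u) ∨ ReadyR2 η f x₀ s hmax R Hs B i v := by
  have hB := hungBox_of_selfShadowR hE hnz hc hcpos hccol hα hαc hFα hdα hsα hFβ hdβ hT hout
  have hcst : StTrkDQ η f x₀ s hmax R Hs B i c := stTrkDQ_of_column hE hnz hc hcpos hccol.le
  rcases succ_or_readyR2_of_hungBox hE hcst hB with h | h
  · exact Or.inl h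
  · exact Or.inr (stateFree_readyR2 η f x₀ s hmax R Hs B i c v h)

/-! ## §4 The push: lineage continuation through a self level, and what is missing for `i₀ < j` -/

/-- ★ LINEAGE CONTINUATION THROUGH A SELF LEVEL.  Same data, level `i` not `WindowReady`, and NO off-axis zero of `f^{(i+1)}` in the cap
`[x₀ + R/2, Re c + Im c)` (instrumentable) ⇒ a COLUMN couple at level `i+1` (the child that ¬local A puts in the open self box lies left of
the wall), so `colCouple_succ_of_cuttable` / `succ_of_columnCuttable` resume at level `i+1`. -/
theorem colCouple_succ_of_selfShadowR {η : ℝ} {f : ℂ → ℂ} {x₀ s hmax R Hs : ℝ} {B i : ℕ} (v : ℂ)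
    (hE : EngineHyps5 2 η f x₀ s hmax R Hs B)
    (hnz : iteratedDeriv i f ≠ 0) {c : ℂ} (hc : iteratedDeriv i f c = 0) (hcpos : 0 < c.im) (hccol : |c.re - x₀| < R / 2)
    {α : ℝ} (hα : x₀ - R / 2 ≤ α) (hαc : α < c.re)
    (hFα : iteratedDeriv i f α ≠ 0) (hdα : deriv (iteratedDeriv i f) α ≠ 0)
    (hsα : ∀ y ∈ Ioc (0 : ℝ) Hs,
      (deriv (iteratedDeriv i f) ((α : ℂ) + (y : ℂ) * I) / iteratedDeriv i f ((α : ℂ) + (y : ℂ) * I)).im < 0)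
    (hFβ : iteratedDeriv i f ((c.re + c.im : ℝ) : ℂ) ≠ 0) (hdβ : deriv (iteratedDeriv i f) ((c.re + c.im : ℝ) : ℂ) ≠ 0)
    (hT : ∀ a : ℂ, iteratedDeriv i f a = 0 → a.im ≠ 0 → |a.im| ≤ |c.re + c.im - a.re|)
    (hnW : ¬ WindowReady η f x₀ s hmax R Hs B i v)
    (hcap : ∀ ρ : ℂ, iteratedDeriv (i + 1) f ρ = 0 → ρ.im ≠ 0 → x₀ + R / 2 ≤ ρ.re → ρ.re < c.re + c.im → False) :
    ColCouple f x₀ R (i + 1) := by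
  have hRpos : 0 < R := R_pos_of_engine hE
  have hHsR : 2 * Hs ≤ R := hE.2.2.2.2.2.2.2.2.2.1
  have hi0 : (0 : ℝ) ≤ (i : ℝ) := by positivity
  have hcHs : c.im ≤ Hs := by
    have h1 := abs_im_le_of_level hE hnz hc
    rwa [abs_of_pos hcpos] at h1
  have hcre : c.re < x₀ + R / 2 := by linarith [(abs_lt.1 hccol).2]
  have hiR : R ≤ ((i : ℝ) + 3) * R / 2 := by nlinarith
  have hβr : c.re + c.im ≤ x₀ + ((i : ℝ) + 3) * R / 2 := by linarith
  have hαr : x₀ - ((i : ℝ) + 3) * R / 2 ≤ α := by linarith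
  have hlt : α < c.re + c.im := by linarith
  have hS : ¬ Shadowed f Hs i (c.re + c.im) := not_shadowed_of_discs i hT
  have hsβ := signedCut_of_not_shadowed hE i ⟨c, hc⟩ hS
  have hR := signedRect_of_cuts hE hnz ⟨c, hc⟩ hlt hFα hFβ hdα hdβ hsα hsβ
  have hJ : ∃ u ∈ Ioo α (c.re + c.im) ×ℂ Ioo (-(Hs + 1)) (Hs + 1), iteratedDeriv i f u = 0 ∧ u.im ≠ 0 :=
    ⟨c, mem_box_of_zero hE hnz hc hαc (by linarith), hc, hcpos.ne'⟩
  rcases offAxisZero_or_windowReady v hαr hβr hR hJ with ⟨ρ, hρ, hz, hρim⟩ | hW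
  · rw [mem_reProdIm] at hρ
    have hρre : ρ.re < x₀ + R / 2 := by
      by_contra hge
      push Not at hge
      exact hcap ρ hz hρim hge hρ.1.2
    have hα' : x₀ - R / 2 < ρ.re := lt_of_le_of_lt hα hρ.1.1
    exact ⟨ρ, hz, hρim, abs_lt.2 ⟨by linarith, by linarith⟩⟩
  · exact absurd hW hnW

/-- ★ THE PUSH, as far as the cumulative data carry it.  Under the crux's binder ¬`ReadyR2` at level `j` and SELF data at a level `i₀ ≤ j`:
a level-`(i₀+1)` band state exists — which is the successor the crux asks for IFF `i₀ = j` (instantiate `i₀ := j`).  For `i₀ < j` see the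
module docstring: the missing datum is a per-level door at levels `i₀+1 … j` (e.g. `colCouple_succ_of_selfShadowR` + cuttability above). -/
theorem succ_of_selfShadowR_le {η : ℝ} {f : ℂ → ℂ} {x₀ s hmax R Hs : ℝ} {B j i₀ : ℕ} (v : ℂ)
    (hE : EngineHyps5 2 η f x₀ s hmax R Hs B) (hnR : ¬ ReadyR2 η f x₀ s hmax R Hs B j v) (hi : i₀ ≤ j)
    {c : ℂ} (hc : iteratedDeriv i₀ f c = 0) (hcpos : 0 < c.im) (hccol : |c.re - x₀| < R / 2)
    {α : ℝ} (hα : x₀ - R / 2 ≤ α) (hαc : α < c.re)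
    (hFα : iteratedDeriv i₀ f α ≠ 0) (hdα : deriv (iteratedDeriv i₀ f) α ≠ 0)
    (hsα : ∀ y ∈ Ioc (0 : ℝ) Hs,
      (deriv (iteratedDeriv i₀ f) ((α : ℂ) + (y : ℂ) * I) / iteratedDeriv i₀ f ((α : ℂ) + (y : ℂ) * I)).im < 0)
    (hFβ : iteratedDeriv i₀ f ((c.re + c.im : ℝ) : ℂ) ≠ 0) (hdβ : deriv (iteratedDeriv i₀ f) ((c.re + c.im : ℝ) : ℂ) ≠ 0)
    (hT : ∀ a : ℂ, iteratedDeriv i₀ f a = 0 → a.im ≠ 0 → |a.im| ≤ |c.re + c.im - a.re|)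
    (hout : ∀ a : ℂ, iteratedDeriv i₀ f a = 0 → 0 < a.im → α < a.re + a.im → a.re - a.im < c.re + c.im → R / 2 < |a.re - x₀| + a.im →
      (max (|a.re - x₀| - R / 2) 0) ^ 2 + (i₀ : ℝ) * a.im ^ 2 ≤ (i₀ : ℝ) * Hs ^ 2) :
    ∃ u : ℂ, StTrkDQ η f x₀ s hmax R Hs B (i₀ + 1) u := by
  have hnRi : ¬ ReadyR2 η f x₀ s hmax R Hs B i₀ v := fun h => hnR (readyR2_mono h hi)
  have hnz := (iteratedDeriv_ne_zero_of_not_readyR2 hE i₀ v hnRi).1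
  exact (succ_or_readyR2_of_selfShadowR v hE hnz hc hcpos hccol hα hαc hFα hdα hsα hFβ hdβ hT hout).resolve_right hnRi

end RhW08.Lens1Shape

namespace RhW08.Lens1Exile

open Complex Set
open scoped ComplexConjugate
open Literature.Analysis.Complex
open Summit.RiemannHypothesis.RiemannHypothesis.Theorems.Splittings.JensenWindow
open RhIdea6.G17.W07C7 RhIdea6.G17.W07C7.Rev6 RhIdea6.G18.W07C8.Law421BirthS RhIdea6.G19.W07C11.Seam
open RhIdea6.G20.W07C12.Frac RhIdea6.G20.W07C12.StColP RhW07.C12.FieldSplit RhIdea6.G21.W07C13.TentMax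
open RhW07.C14.TwoSided RhW07.C14.Classes RhW07.C14.Lineage RhW07.C14.Booking
open RhW07.C13.Heredity RhIdea6.G22.W07C15pre.Injection RhW07.E3.Cell RhW07.E3.Lit
open RhW08.Round1 RhW08.StSwap RhW08.Round2 RhW08.QuadW RhW08.SealSwapQ RhW08.SealSwap RhW08.SuccB RhW08.SuccSplit
open RhW08.SuccTheft RhW08.Column RhW08.Hurwitz RhW08.ClusterQ RhW08.ClusterQM RhW08.NewtonDoor RhW08.NewtonDoorGenusOne RhW08.PurseP
open RhW08.AntiEscapeSplit7
open RhW08.Lens1SignCut RhW08.Lens1Coverage RhW08.LineageQ RhW08.Lens1Shape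

/-- A GOOD CUT at abscissa `x`, level `i`: both feet non-vanishing and the boundary sign `Im (F′/F) < 0` on the heights `(0, Hs]`
(`RhW08.Lens1Shape.signedCut_of_not_shadowed`: any `x` that is neither `Shadowed` nor a `BadFoot` is a good cut). -/
def GoodCut (f : ℂ → ℂ) (Hs : ℝ) (i : ℕ) (x : ℝ) : Prop :=
  iteratedDeriv i f (x : ℂ) ≠ 0 ∧ deriv (iteratedDeriv i f) (x : ℂ) ≠ 0 ∧
    ∀ y ∈ Ioc (0 : ℝ) Hs, (deriv (iteratedDeriv i f) ((x : ℂ) + (y : ℂ) * I) / iteratedDeriv i f ((x : ℂ) + (y : ℂ) * I)).im < 0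

/-- TYPED OPEN STATEMENT (column currency; (CA521)(3)'s suggested shape, one-level pedigree form) — COLUMN RE-ENTRY: a column couple at
level `k`, no Ready′ level `≤ k+1`, and a level-(k+1) band state within `Hs` of the column ⇒ a column couple at level `k+1`.
MODEL-SUSPECT (module docstring: one-pair tilt frame, `γ = 4`, exit at level 7); recorded so that no later seat re-derives it. -/
def ColReEntryLaw : Prop :=
  ∀ (η : ℝ) (f : ℂ → ℂ) (x₀ s hmax R Hs : ℝ) (B : ℕ), EngineHyps5 2 η f x₀ s hmax R Hs B → ∀ (k : ℕ) (v : ℂ),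
    ¬ ReadyR2 η f x₀ s hmax R Hs B (k + 1) v → ColCouple f x₀ R k →
    (∃ u : ℂ, StTrkDQ η f x₀ s hmax R Hs B (k + 1) u ∧ |u.re - x₀| < R / 2 + Hs) → ColCouple f x₀ R (k + 1)

/-- ★ TYPED OPEN STATEMENT (band currency, level `j`, local) — NO TOTAL EXILE: the v10q stub's binders plus a signed window
`α < Re v < β` inside the level-`j` range ⇒ a level-(j+1) band state.  By `exists_outOfBand_intruder` the window necessarily contains
an out-of-band upper zero poking out of the column (else K-GAP gives `HungBox`), so the content is: the children of the cluster of the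
lowest band state are not ALL exiled under out-of-band discs. -/
def BandExileLaw : Prop :=
  ∀ (η : ℝ) (f : ℂ → ℂ) (x₀ s hmax R Hs : ℝ) (B : ℕ), EngineHyps5 2 η f x₀ s hmax R Hs B → ∀ (j : ℕ) (v : ℂ),
    IsLowest StTrkDQ η f x₀ s hmax R Hs B j v → ¬ ReadyR2 η f x₀ s hmax R Hs B j v →
    ¬ AllInBandInRangeWindow f x₀ R Hs j v → ¬ Dimple f j v → DiscOverlap f j v →
    iteratedDeriv (j + 1) f v ≠ 0 →
    ¬ CellF f j v → ¬ CellNb f x₀ R Hs j v → ¬ LandingDipDeep f x₀ R Hs j v → ¬ LandingDipW f x₀ R Hs j v →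
    ¬ IsolatedNewtonL f x₀ R Hs j v → ¬ HungBox f x₀ R Hs j → (∃ i : ℕ, i ≤ j ∧ ¬ ColumnCuttable f x₀ R Hs i) →
    ∀ α β : ℝ, x₀ - ((j : ℝ) + 3) * R / 2 ≤ α → β ≤ x₀ + ((j : ℝ) + 3) * R / 2 → α < v.re → v.re < β →
    GoodCut f Hs j α → GoodCut f Hs j β →
    ∃ u : ℂ, StTrkDQ η f x₀ s hmax R Hs B (j + 1) u

/-- ★ TYPED OPEN STATEMENT (global sign coverage) — CUT WINDOW: under the v10q stub's binders, either a successor exists already or the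
lowest band state admits a signed window inside the range.  Inhabitant of its failure: a CURTAIN (shadow chain of upper zeros of `f^{(j)}`
from within `Hs` of `Re v` to the range edge) on at least one side, together with total absence of level-(j+1) band states. -/
def CutWindowLaw : Prop :=
  ∀ (η : ℝ) (f : ℂ → ℂ) (x₀ s hmax R Hs : ℝ) (B : ℕ), EngineHyps5 2 η f x₀ s hmax R Hs B → ∀ (j : ℕ) (v : ℂ),
    IsLowest StTrkDQ η f x₀ s hmax R Hs B j v → ¬ ReadyR2 η f x₀ s hmax R Hs B j v →
    ¬ AllInBandInRangeWindow f x₀ R Hs j v → ¬ Dimple f j v → DiscOverlap f j v →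
    iteratedDeriv (j + 1) f v ≠ 0 →
    ¬ CellF f j v → ¬ CellNb f x₀ R Hs j v → ¬ LandingDipDeep f x₀ R Hs j v → ¬ LandingDipW f x₀ R Hs j v →
    ¬ IsolatedNewtonL f x₀ R Hs j v → ¬ HungBox f x₀ R Hs j → (∃ i : ℕ, i ≤ j ∧ ¬ ColumnCuttable f x₀ R Hs i) →
    (∃ u : ℂ, StTrkDQ η f x₀ s hmax R Hs B (j + 1) u) ∨
      ∃ α β : ℝ, x₀ - ((j : ℝ) + 3) * R / 2 ≤ α ∧ β ≤ x₀ + ((j : ℝ) + 3) * R / 2 ∧ α < v.re ∧ v.re < β ∧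
        GoodCut f Hs j α ∧ GoodCut f Hs j β

/-- The candidate v11q split (logic only): NO-TOTAL-EXILE and CUT-WINDOW together give the v10q SUCC stub `RegHungCut10S`. -/
theorem regHungCut10S_of_exile_window (hX : BandExileLaw) (hW : CutWindowLaw) : RegHungCut10S := by
  intro η f x₀ s hmax R Hs B hE j v hlow hnR hwin hdim hov hz hnF hnNb hnD hnW hnI hB hcut
  rcases hW η f x₀ s hmax R Hs B hE j v hlow hnR hwin hdim hov hz hnF hnNb hnD hnW hnI hB hcut with h | ⟨α, β, hα, hβ, hαv, hvβ, hgα, hgβ⟩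
  · exact h
  · exact hX η f x₀ s hmax R Hs B hE j v hlow hnR hwin hdim hov hz hnF hnNb hnD hnW hnI hB hcut α β hα hβ hαv hvβ hgα hgβ

/-- Conversely the stub gives both laws (so the split loses nothing). -/
theorem exile_window_of_regHungCut10S (h : RegHungCut10S) : BandExileLaw ∧ CutWindowLaw :=
  ⟨fun η f x₀ s hmax R Hs B hE j v hlow hnR hwin hdim hov hz hnF hnNb hnD hnW hnI hB hcut _ _ _ _ _ _ _ _ =>
      h η f x₀ s hmax R Hs B hE j v hlow hnR hwin hdim hov hz hnF hnNb hnD hnW hnI hB hcut,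
    fun η f x₀ s hmax R Hs B hE j v hlow hnR hwin hdim hov hz hnF hnNb hnD hnW hnI hB hcut =>
      Or.inl (h η f x₀ s hmax R Hs B hE j v hlow hnR hwin hdim hov hz hnF hnNb hnD hnW hnI hB hcut)⟩

/-- ★★ THE EXILE INHABITANT SHAPE (proved, contrapositive of the K-GAP door `RhW08.Lens1Shape.hungBox_of_cuts_inBand`): on a legal frame,
two good cuts `α < β` in the level-`i` range bracketing a couple and NO hung box at level `i` force an upper zero `a` of `f^{(i)}` whose
Jensen disc pokes out of the closed column (`R/2 < |Re a − x₀| + Im a`), whose shadow meets `(α, β)`, and which VIOLATES the level-`i`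
band inequality — the out-of-band intruder `a★` of the EXILE lens. -/
theorem exists_outOfBand_intruder {η : ℝ} {f : ℂ → ℂ} {x₀ s hmax R Hs : ℝ} {B i : ℕ} (hE : EngineHyps5 2 η f x₀ s hmax R Hs B)
    {α β : ℝ} (hαr : x₀ - ((i : ℝ) + 3) * R / 2 ≤ α) (hβr : β ≤ x₀ + ((i : ℝ) + 3) * R / 2) (hlt : α < β)
    (hgα : GoodCut f Hs i α) (hgβ : GoodCut f Hs i β)
    (hJ : ∃ u : ℂ, iteratedDeriv i f u = 0 ∧ u.im ≠ 0 ∧ α < u.re ∧ u.re < β) (hB : ¬ HungBox f x₀ R Hs i) :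
    ∃ a : ℂ, iteratedDeriv i f a = 0 ∧ 0 < a.im ∧ α < a.re + a.im ∧ a.re - a.im < β ∧ R / 2 < |a.re - x₀| + a.im ∧
      (i : ℝ) * Hs ^ 2 < (max (|a.re - x₀| - R / 2) 0) ^ 2 + (i : ℝ) * a.im ^ 2 := by
  by_contra hno
  push Not at hno
  obtain ⟨u, hu, huim, -, -⟩ := id hJ
  have hnz : iteratedDeriv i f ≠ 0 := fun h0 => hgα.1 (by rw [h0]; rfl)
  exact hB (hungBox_of_cuts_inBand hE hnz hαr hβr hlt hgα.1 hgβ.1 hgα.2.1 hgβ.2.1 hgα.2.2 hgβ.2.2 hJ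
    (fun a ha hapos h1 h2 h3 => hno a ha hapos h1 h2 h3))

end RhW08.Lens1Exile

#print axioms RhW08.Lens1Exile.regHungCut10S_of_exile_window
#print axioms RhW08.Lens1Exile.exists_outOfBand_intruder
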